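import Literature.AnabelianGeometry.AbsoluteAnabelian.AbsTopII.TwoTripodNodalProp13viiiHolds
import Literature.AnabelianGeometry.AbsoluteAnabelian.AbsTopII.InertiaGroupsLogPoints
import HarnessLib

/-!
# [AbsTopII] Prop 1.3 (x) at the two-vertex nodal datum, I: the log points of the degenerating 4-pointed sphere

S. Mochizuki, *Topics in Absolute Anabelian Geometry II* [AbsTopII] (bib `MochizukiAbsTopII2013`; locators =
PDF pages of the kurims manuscript `paper:url-585b8d0ad0d9`), §1, Def 1.2 (ii) p. 10, Prop 1.3 (x) p. 12:

> "(x) Let `τ_I : I → Π_I` be the [outer] homomorphism that arises [by functoriality!] from a 'log point'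
> `τ_S ∈ X^{log}(S^{log})`. […] if `τ_I` is non-verticial and non-edge-like, then the image of `τ_S` is the
> unique cusp `e_τ` of `X` such that [for an appropriate choice of conjugate of `D_{e_τ}`] `τ_I(I) ⊆ D_{e_τ}`.  Now
> suppose that the image of `τ_S` is not a cusp.  Then `τ_I` satisfies the condition `τ_I(I) = I_{v_τ}` […] if and
> only if the image of `τ_S` is a non-nodal point of the irreducible component of `X` corresponding to `v_τ`; […]"

MODEL/CONSTRUCTION file (abc-iut-f-066 gen 7, row «P13x″-TWO-VERTEX»; cell layer L4, [AbsTopII] Prop 1.3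
non-vacuity column), companion of `AbsTopII/TwoTripodNodalDatum.lean` (the DPSC datum `M.dpsc` of the DEGENERATING
4-POINTED SPHERE: two tripods `v_A`, `v_B`, ONE non-loop node `e` (regular smoothing, `Σ`-index `i^Σ_e = 1`), cusps `c₁, c₂ | c₃, c₀`,
`Π_H = Π_I = P` a pro-`Σ` completion of `Γ_{0,4} ⋊_τ ℤ`, `I_{v_A} = T`, `I_{v_B} = U`).  It supplies the FAMILY of
labelled sections `M.logPoints : M.LogPt → (M.dpsc …).LogPointData` on which the statement of record
`DPSCIndexData.Prop_1_3_x''` (typer abc-iut-L4-t6, `InertiaGroupsLogPoints.lean`; Prop 1.3 (x) for the log points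
SUPPLIED BY THE MODEL) is evaluated in the proof-only companions `TwoTripodNodalSlopeSections.lean` (II, engine) and
`TwoTripodNodalProp13x.lean` (III, the clauses):

* SMOOTH (non-cuspidal, non-nodal) points of the component `v` ↦ the sections `δ I_v δ⁻¹`, `δ ∈ P`;
* the log points mapping to the CUSP `c_j` ↦ the SLOPE-`n` SECTIONS `δ S_{j,n} δ⁻¹`, `n ≥ 1`, where
  `S_{j,n} := closure ⟨ι(c_j)^n · s_j⟩` with `s_j = t₀` (`j = 1, 2`), `s_j = u₀` (`j = 3, 0`) the generator of the
  inertia section of the cusp's vertex: the sections of `D_{c_j} ↠ I` are the graphs of the continuous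
  homomorphisms `I_v → Π_{c_j}`, and a log point over the marked point `c_j` sends the divisor class to
  `n·e + (unit)` with `n ≥ 1` (its `α`-image vanishes at `c_j`), whence slope `n ≥ 1` (slope `0` is `I_v` itself);
* NO member over the node: the datum is the REGULAR smoothing (`i_e = 1`, whence the recorded `Σ`-index
  `i^Σ_e = 1`, `TwoTripodNodalDatum.lean`), and in the stalk `M_e` one has `ξ + η = i_e · σ` (Ex 1.1 (iii) p. 9),
  while a log point over the node needs `ξ ↦ a·σ + (unit)`, `η ↦ b·σ + (unit)` with `a, b ≥ 1` (`ξ`, `η` vanish at the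
  node) — impossible for `a + b = 1` (over the loop datum `DehnTwist.dpsc i` of abc-iut-L4-t6 the node members are
  exactly the slopes `0 < m < i`).  CAVEAT (recorded, not hidden): the same profinite data also underlie smoothings
  with `i_e > 1` prime to `Σ`, which DO have log points over the node; those are not modelled here.  The node clause
  of Prop 1.3 (x) is nevertheless not idle: its left-hand side is REFUTED for every member (companion file III).

Group theory of the slope sections (`cuspSection_inf_PiG`, `cuspSection_sup_PiG`): the section `S_{j,n}` meets
`Π_𝔾` trivially because it lies in the GRAPH `{θ(s)·s}` of a continuous `θ : P → Π_{c_j}` with `θ(t₀) = ι(c_j)^n`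
killing `Π_𝔾` (the retraction `P → T` of abc-iut-f-066 gen 5 followed by the pro-`Σ` universal property of
`T ≅ Ẑ^Σ`), and `S_{j,n} · Π_𝔾 = P` is part XI of the `IsProSigmaCompletion` series.
HONEST FRAMING: constructed ≠ geometric (the family is the model's LABEL for the log points of the degenerate curve,
read off the log structure as above; Riemann existence / log specialisation are not in the tree); definitions + their
defining lemmas, nothing of Prop 1.3 (x) is asserted here; no side taken on [IUTchIII] Cor 3.12.
-/

noncomputable section

open scoped Pointwise

namespace Literature.AnabelianGeometry.AbsoluteAnabelian.AbsTopII.TwoTripodNodal.Model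

open Literature.AnabelianGeometry.SemiGraphs
open Literature.AnabelianGeometry.SemiGraphs.SemiGraphOfAnabelioids (IsProSigmaCompletion)
open Literature.AnabelianGeometry.SemiGraphs.SemiGraphOfAnabelioids.IsProSigmaCompletion
open Literature.AnabelianGeometry.Anabelioids (IsSigmaInteger)
open Literature.GroupTheory.CombinatorialGroupTheory
open Literature.GroupTheory.CombinatorialGroupTheory.PuncturedSurfaceGroup
open _root_.Topology

variable {Sigma : Set ℕ} (M : Model Sigma)

/-! ### Conjugates of sections -/

/-- A conjugate of a closed subgroup of the profinite `P` is closed. [cite: MochizukiAbsTopII2013, Def 1.2 (ii) p.10] -/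
theorem isClosed_conj_smul {H : Subgroup M.P} (hH : IsClosed (H : Set M.P)) (δ : M.P) :
    IsClosed ((MulAut.conj δ • H : Subgroup M.P) : Set M.P) := by
  rw [Subgroup.coe_pointwise_smul]
  have hc : Continuous fun x : M.P => MulAut.conj δ • x := (continuous_const.mul continuous_id).mul continuous_const
  exact (hH.isCompact.image hc).isClosed

/-- Conjugating a complement of the normal subgroup `Π_𝔾` keeps it disjoint from `Π_𝔾`.
[cite: MochizukiAbsTopII2013, Prop 1.3 (iii) p.11] -/
theorem conj_smul_inf_PiG_eq_bot {H : Subgroup M.P} (hH : H ⊓ M.PiG = ⊥) (δ : M.P) :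
    MulAut.conj δ • H ⊓ M.PiG = ⊥ := by
  haveI := M.normal_PiG
  rw [← Subgroup.Normal.conj_smul_eq_self δ M.PiG, ← Subgroup.smul_inf, hH, Subgroup.smul_bot]

/-- Conjugating a supplement of the normal subgroup `Π_𝔾` keeps it a supplement.
[cite: MochizukiAbsTopII2013, Prop 1.3 (iii) p.11] -/
theorem conj_smul_sup_PiG_eq_top {H : Subgroup M.P} (hH : H ⊔ M.PiG = ⊤) (δ : M.P) :
    MulAut.conj δ • H ⊔ M.PiG = ⊤ := by
  haveI := M.normal_PiG
  rw [eq_top_iff]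
  intro x _
  have hx : (MulAut.conj δ)⁻¹ • x ∈ H ⊔ M.PiG := hH ▸ Subgroup.mem_top _
  have h := Subgroup.smul_mem_pointwise_smul _ (MulAut.conj δ) _ hx
  rwa [smul_inv_smul, Subgroup.smul_sup, Subgroup.Normal.conj_smul_eq_self δ M.PiG] at h

/-- `P = Π_𝔾 · S` for a supplement `S`: every `δ ∈ P` is `γ · s` with `γ ∈ Π_𝔾`, `s ∈ S`.
[cite: MochizukiAbsTopII2013, Def 1.2 (ii) p.10] -/
theorem exists_eq_mul_of_sup_eq_top {S : Subgroup M.P} (hS : S ⊔ M.PiG = ⊤) (δ : M.P) :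
    ∃ γ ∈ M.PiG, ∃ s ∈ S, δ = γ * s := by
  haveI := M.normal_PiG
  have h : δ ∈ ((M.PiG ⊔ S : Subgroup M.P) : Set M.P) := by
    rw [sup_comm, hS]; exact Subgroup.mem_top δ
  rw [Subgroup.normal_mul] at h
  obtain ⟨γ, hγ, s, hs, rfl⟩ := Set.mem_mul.mp h
  exact ⟨γ, hγ, s, hs, rfl⟩

/-! ### The base sections of the four cusps: `T` at `c₁, c₂`, `U` at `c₃, c₀` -/

/-- The twist offset of the cusp `c_j`: `1` for the cusps `c₁, c₂` at `v_A` (fixed by the Dehn twist), `(c₁c₂)⁻¹` for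
the cusps `c₃, c₀` at `v_B` (conjugated by the node element). [cite: MochizukiAbsTopII2013, Def 1.2 (ii) p.10] -/
def cuspTwist : Fin 4 → PuncturedSurfaceGroup 0 4 := ![(c 1 * c 2)⁻¹, 1, 1, (c 1 * c 2)⁻¹]

/-- The generator `s_j = ι(inl w_j · inr 1)` of the inertia section of the cusp's vertex: `t₀` for `c₁, c₂`, `u₀` for
`c₃, c₀`. [cite: MochizukiAbsTopII2013, Prop 1.3 (iii) p.11] -/
def baseGen (j : Fin 4) : M.P :=
  M.ι (SemidirectProduct.inl (cuspTwist j) * SemidirectProduct.inr (Multiplicative.ofAdd (1 : ℤ)))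

/-- The inertia section `I_v` of the cusp's vertex: `T = I_{v_A}` for `c₁, c₂`, `U = I_{v_B}` for `c₃, c₀`.
[cite: MochizukiAbsTopII2013, Prop 1.3 (iii) p.11] -/
def baseSec : Fin 4 → Subgroup M.P := ![M.U, M.T, M.T, M.U]

/-- `baseSec 0 = U` (cusp `c₀` at `v_B`). [cite: MochizukiAbsTopII2013, Prop 1.3 (iii) p.11] -/
theorem baseSec_zero : M.baseSec 0 = M.U := rfl

/-- `baseSec 1 = T` (cusp `c₁` at `v_A`). [cite: MochizukiAbsTopII2013, Prop 1.3 (iii) p.11] -/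
theorem baseSec_one : M.baseSec 1 = M.T := rfl

/-- `baseSec 2 = T` (cusp `c₂` at `v_A`). [cite: MochizukiAbsTopII2013, Prop 1.3 (iii) p.11] -/
theorem baseSec_two : M.baseSec 2 = M.T := rfl

/-- `baseSec 3 = U` (cusp `c₃` at `v_B`). [cite: MochizukiAbsTopII2013, Prop 1.3 (iii) p.11] -/
theorem baseSec_three : M.baseSec 3 = M.U := rfl

/-- `baseSec j = closure ⟨s_j⟩`. [cite: MochizukiAbsTopII2013, Prop 1.3 (iii) p.11] -/
theorem baseSec_eq_closure_zpowers (j : Fin 4) :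
    M.baseSec j = (Subgroup.zpowers (M.baseGen j)).topologicalClosure := by
  fin_cases j
  · rfl
  · exact M.T_eq_closure_zpowers
  · exact M.T_eq_closure_zpowers
  · rfl

/-- `s_j ∈ baseSec j`. [cite: MochizukiAbsTopII2013, Prop 1.3 (iii) p.11] -/
theorem baseGen_mem_baseSec (j : Fin 4) : M.baseGen j ∈ M.baseSec j := by
  rw [baseSec_eq_closure_zpowers]
  exact Subgroup.le_topologicalClosure _ (Subgroup.mem_zpowers _)

/-- `baseSec j` is closed. [cite: MochizukiAbsTopII2013, Prop 1.3 (iii) p.11] -/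
theorem isClosed_baseSec (j : Fin 4) : IsClosed ((M.baseSec j : Subgroup M.P) : Set M.P) := by
  rw [baseSec_eq_closure_zpowers]; exact Subgroup.isClosed_topologicalClosure _

/-- `baseSec j ∩ Π_𝔾 = 1`. [cite: MochizukiAbsTopII2013, Prop 1.3 (iii) p.11] -/
theorem baseSec_inf_PiG (hne : Sigma.Nonempty) (hprime : ∀ p ∈ Sigma, p.Prime) (j : Fin 4) :
    M.baseSec j ⊓ M.PiG = ⊥ := by
  fin_cases j
  · exact M.U_inf_PiG hne hprime
  · exact M.T_inf_PiG
  · exact M.T_inf_PiG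
  · exact M.U_inf_PiG hne hprime

/-- `baseSec j · Π_𝔾 = P`. [cite: MochizukiAbsTopII2013, Prop 1.3 (iii) p.11] -/
theorem baseSec_sup_PiG (j : Fin 4) : M.baseSec j ⊔ M.PiG = ⊤ := by
  fin_cases j
  · exact M.U_sup_PiG
  · exact M.T_sup_PiG
  · exact M.T_sup_PiG
  · exact M.U_sup_PiG

/-- `baseSec j` centralises `ι(Π_{c_j})`. [cite: MochizukiAbsTopII2013, Prop 1.3 (iii) p.11] -/
theorem baseSec_le_centralizer_cuspGp (j : Fin 4) :
    M.baseSec j ≤ Subgroup.centralizer (((M.cuspGp j).map M.PiG.subtype : Subgroup M.P) : Set M.P) := by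
  fin_cases j
  · exact M.U_le_centralizer_cuspGp M.twist_c_zero
  · exact M.T_le_centralizer_cuspGp M.twist_c_one
  · exact M.T_le_centralizer_cuspGp M.twist_c_two
  · exact M.U_le_centralizer_cuspGp M.twist_c_three

/-- `baseSec j = I_v` for the vertex `v` of the cusp `c_j`. [cite: MochizukiAbsTopII2013, Prop 1.3 (iii) p.11] -/
theorem baseSec_eq_Iv (hne : Sigma.Nonempty) (hprime : ∀ p ∈ Sigma, p.Prime) (j : Fin 4) :
    M.baseSec j = (M.dpsc hne hprime).Iv ((M.dpsc hne hprime).cuspVert ⟨j⟩) := by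
  fin_cases j
  · exact (M.Iv_eq_U hne hprime).symm
  · exact (M.Iv_eq_T hne hprime).symm
  · exact (M.Iv_eq_T hne hprime).symm
  · exact (M.Iv_eq_U hne hprime).symm

/-- `D_{c_j} = ι(Π_{c_j}) · baseSec j`. [cite: MochizukiAbsTopII2013, Prop 1.3 (vii) p.12] -/
theorem DvCusp_eq_sup_baseSec (hne : Sigma.Nonempty) (hprime : ∀ p ∈ Sigma, p.Prime) (j : Fin 4) :
    (M.dpsc hne hprime).DvCusp ⟨j⟩ = (M.cuspGp j).map M.PiG.subtype ⊔ M.baseSec j := by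
  fin_cases j
  · exact M.DvCusp_zero_eq hne hprime
  · exact M.DvCusp_one_eq hne hprime
  · exact M.DvCusp_two_eq hne hprime
  · exact M.DvCusp_three_eq hne hprime

/-- `D_{c_j}` is closed. [cite: MochizukiAbsTopII2013, Prop 1.3 (vii) p.12] -/
theorem isClosed_DvCusp (hne : Sigma.Nonempty) (hprime : ∀ p ∈ Sigma, p.Prime) (j : Fin 4) :
    IsClosed (((M.dpsc hne hprime).DvCusp ⟨j⟩ : Set (M.dpsc hne hprime).PiH)) := by
  rw [DvCusp_eq_sup_baseSec]
  have hK : IsClosed ((((M.cuspGp j).map M.PiG.subtype : Subgroup M.P)) : Set M.P) := by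
    rw [cuspGp_map_eq]; exact Subgroup.isClosed_topologicalClosure _
  exact (M.isClosed_sup_of_commute hK (M.isClosed_baseSec j) fun a ha b hb =>
    (Subgroup.mem_centralizer_iff.mp (M.baseSec_le_centralizer_cuspGp j hb) a ha)).2

/-! ### The homomorphism `θ : P → Π_{c_j}` with `θ(t₀) = ι(c_j)^n`, trivial on `Π_𝔾` -/

/-- **The slope homomorphism.**  For every cusp `c_j` and `n : ℕ` there is a continuous homomorphism `θ : P → P`
with values in `ι(Π_{c_j})`, trivial on `Π_𝔾`, and `θ(t₀) = ι(c_j)^n`: the retraction `P ↠ T` (kernel `Π_𝔾`)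
followed by the continuous extension `T → Π_𝔾` of `t₀ ↦ ι(c_j)^n` (universal property of the pro-`Σ` completion
`ℤ → T`). [cite: MochizukiSemiAnbd2006, Ex. 2.10 p.31] -/
theorem exists_theta (j : Fin 4) (n : ℕ) : ∃ θ : M.P →* M.P, Continuous θ ∧
    (∀ x, θ x ∈ (M.cuspGp j).map M.PiG.subtype) ∧
    θ (M.ι (SemidirectProduct.inr (Multiplicative.ofAdd (1 : ℤ)))) =
      M.ι (SemidirectProduct.inl (c j ^ n : PuncturedSurfaceGroup 0 4)) ∧
    ∀ a ∈ M.PiG, θ a = 1 := by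
  haveI : CompactSpace ↥M.T := isCompact_iff_compactSpace.mp (Subgroup.isClosed_topologicalClosure _).isCompact
  haveI : CompactSpace ↥M.PiG := isCompact_iff_compactSpace.mp M.isClosed_PiG.isCompact
  obtain ⟨κ, hκ, hκv⟩ := M.exists_kappaT_all
  obtain ⟨ψ, hψc, hψκ⟩ := exists_continuous_extend_profinite hκ M.isProSigmaCompletion_κG.index_open
    (zpowersHom ↥M.PiG (M.κG (c j ^ n)))
  obtain ⟨F, hFc, -, hFT, hFA⟩ : ∃ F : M.P →* ↥M.T, Continuous F ∧
      (∀ x, (F (M.ι x) : M.P) = M.ι (SemidirectProduct.inr (SemidirectProduct.rightHom x))) ∧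
      (∀ (t : M.P) (_ : t ∈ M.T), (F t : M.P) = t) ∧ ∀ a ∈ M.PiG, F a = 1 :=
    SemidirectCofinal.exists_retraction M.φ M.isProSigmaCompletion
  -- `ψ(T) ⊆ Π_{c_j}` by density of `κ(ℤ)` in `T`
  have hmem : M.κG (c j ^ n) ∈ M.cuspGp j :=
    Subgroup.le_topologicalClosure _ (Subgroup.mem_map_of_mem _
      (by rw [PuncturedSurfaceGroup.cuspInertia]; exact Subgroup.pow_mem _ (Subgroup.mem_zpowers _) n))
  have hψval : ∀ t, ψ t ∈ M.cuspGp j := by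
    have hcl : IsClosed (((M.cuspGp j).comap ψ : Subgroup ↥M.T) : Set ↥M.T) :=
      (Subgroup.isClosed_topologicalClosure _).preimage hψc
    have hsub : Set.range κ ⊆ (((M.cuspGp j).comap ψ : Subgroup ↥M.T) : Set ↥M.T) := by
      rintro _ ⟨m, rfl⟩
      rw [SetLike.mem_coe, Subgroup.mem_comap, hψκ, zpowersHom_apply]
      exact Subgroup.zpow_mem _ hmem _
    intro t
    have ht : t ∈ closure (Set.range κ) := hκ.dense.closure_eq ▸ Set.mem_univ t
    exact hcl.closure_subset_iff.mpr hsub ht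
  refine ⟨M.PiG.subtype.comp (ψ.comp F), continuous_subtype_val.comp (hψc.comp hFc), fun x => ?_, ?_, fun a ha => ?_⟩
  · exact ⟨ψ (F x), hψval _, rfl⟩
  · have h1 : F (M.ι (SemidirectProduct.inr (Multiplicative.ofAdd (1 : ℤ)))) = κ (Multiplicative.ofAdd (1 : ℤ)) :=
      Subtype.ext (by rw [hFT _ M.t0_mem_T, hκv])
    rw [MonoidHom.comp_apply, MonoidHom.comp_apply, h1, hψκ, zpowersHom_apply, toAdd_ofAdd, zpow_one,
      Subgroup.coe_subtype, coe_κG]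
  · rw [MonoidHom.comp_apply, MonoidHom.comp_apply, hFA a ha, map_one, map_one]

/-! ### The slope sections of the cusps -/

/-- The generator `ι(c_j)^n · s_j = ι(inl (c_j^n · w_j) · inr 1)` of the slope-`n` section at the cusp `c_j`.
[cite: MochizukiAbsTopII2013, Prop 1.3 (x) p.12] -/
def cuspGen (j : Fin 4) (n : ℕ) : M.P :=
  M.ι (SemidirectProduct.inl (c j ^ n * cuspTwist j) * SemidirectProduct.inr (Multiplicative.ofAdd (1 : ℤ)))

/-- **The slope-`n` section at the cusp `c_j`**: `S_{j,n} := closure ⟨ι(c_j)^n · s_j⟩` — the graph of the continuous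
homomorphism `I_v → Π_{c_j}`, `s_j ↦ ι(c_j)^n`, inside `D_{c_j} = Π_{c_j} · I_v`.
[cite: MochizukiAbsTopII2013, Prop 1.3 (x) p.12] -/
def cuspSection (j : Fin 4) (n : ℕ) : Subgroup M.P := (Subgroup.zpowers (M.cuspGen j n)).topologicalClosure

/-- `ι(c_j)^n · s_j = ι(inl c_j^n) · s_j`. [cite: MochizukiAbsTopII2013, Prop 1.3 (x) p.12] -/
theorem cuspGen_eq (j : Fin 4) (n : ℕ) :
    M.cuspGen j n = M.ι (SemidirectProduct.inl (c j ^ n : PuncturedSurfaceGroup 0 4)) * M.baseGen j := by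
  rw [cuspGen, baseGen, map_mul SemidirectProduct.inl, mul_assoc, map_mul]

/-- Slope `0` is the inertia section itself: `S_{j,0} = I_v`. [cite: MochizukiAbsTopII2013, Prop 1.3 (x) p.12] -/
theorem cuspSection_zero (j : Fin 4) : M.cuspSection j 0 = M.baseSec j := by
  rw [cuspSection, baseSec_eq_closure_zpowers, cuspGen_eq, pow_zero, map_one, map_one, one_mul]

/-- `S_{j,n}` is closed. [cite: MochizukiAbsTopII2013, Prop 1.3 (x) p.12] -/
theorem isClosed_cuspSection (j : Fin 4) (n : ℕ) : IsClosed ((M.cuspSection j n : Subgroup M.P) : Set M.P) :=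
  Subgroup.isClosed_topologicalClosure _

/-- `ι(c_j)^n · s_j ∈ S_{j,n}`. [cite: MochizukiAbsTopII2013, Prop 1.3 (x) p.12] -/
theorem cuspGen_mem_cuspSection (j : Fin 4) (n : ℕ) : M.cuspGen j n ∈ M.cuspSection j n :=
  Subgroup.le_topologicalClosure _ (Subgroup.mem_zpowers _)

/-- **`S_{j,n} · Π_𝔾 = P`** (part XI of the completion series: every twisted section supplements `Π_𝔾`).
[cite: MochizukiAbsTopII2013, Prop 1.3 (x) p.12] -/
theorem cuspSection_sup_PiG (j : Fin 4) (n : ℕ) : M.cuspSection j n ⊔ M.PiG = ⊤ :=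
  SemidirectCofinal.closure_zpowers_twisted_sup_closure_inl_eq_top M.φ M.isProSigmaCompletion _

/-- `ι(inl c_j^n) ∈ ι(Π_{c_j})`. [cite: MochizukiAbsTopII2013, Def 1.2 (ii) p.10] -/
theorem inl_pow_mem_cuspGp_map (j : Fin 4) (n : ℕ) :
    M.ι (SemidirectProduct.inl (c j ^ n : PuncturedSurfaceGroup 0 4)) ∈ (M.cuspGp j).map M.PiG.subtype := by
  rw [cuspGp_map_eq, map_pow, map_pow]
  exact Subgroup.pow_mem _ (Subgroup.le_topologicalClosure _ (Subgroup.mem_zpowers _)) n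

/-- **`S_{j,n} ∩ Π_𝔾 = 1`**: `S_{j,n}` lies in the graph `{θ(s)·s : s ∈ I_v}` of the slope homomorphism `θ`
(`θ(I_v) ⊆ Π_{c_j}` commutes with `I_v`), which meets `Π_𝔾` trivially since `I_v` does.
[cite: MochizukiAbsTopII2013, Prop 1.3 (x) p.12] -/
theorem cuspSection_inf_PiG (hne : Sigma.Nonempty) (hprime : ∀ p ∈ Sigma, p.Prime) (j : Fin 4) (n : ℕ) :
    M.cuspSection j n ⊓ M.PiG = ⊥ := by
  obtain ⟨θ, hθc, hθK, hθt, hθA⟩ := M.exists_theta j n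
  have hKle : (M.cuspGp j).map M.PiG.subtype ≤ M.PiG := Subgroup.map_subtype_le _
  have hcomm : ∀ s ∈ M.baseSec j, ∀ x, θ x * s = s * θ x := fun s hs x =>
    Subgroup.mem_centralizer_iff.mp (M.baseSec_le_centralizer_cuspGp j hs) (θ x) (hθK x)
  -- the graph homomorphism `s ↦ θ(s)·s` on `I_v = baseSec j`
  let g : ↥(M.baseSec j) →* M.P :=
    { toFun := fun s => θ s * s
      map_one' := by rw [Subgroup.coe_one, map_one, one_mul]
      map_mul' := fun a b => by
        rw [Subgroup.coe_mul, map_mul, mul_assoc (θ a), ← mul_assoc (θ b), hcomm a a.2 b, mul_assoc, mul_assoc] }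
  have hgc : Continuous g := (hθc.comp continuous_subtype_val).mul continuous_subtype_val
  haveI : CompactSpace ↥(M.baseSec j) := isCompact_iff_compactSpace.mp (M.isClosed_baseSec j).isCompact
  have hclosed : IsClosed ((g.range : Subgroup M.P) : Set M.P) := by
    rw [MonoidHom.coe_range]; exact (isCompact_range hgc).isClosed
  have hinf : g.range ⊓ M.PiG = ⊥ := by
    rw [eq_bot_iff]
    rintro x ⟨⟨s, rfl⟩, hxA⟩
    have hsA : (s : M.P) ∈ M.PiG := by
      have h : θ (s : M.P) * (s : M.P) ∈ M.PiG := hxA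
      exact (Subgroup.mul_mem_cancel_left M.PiG (hKle (hθK (s : M.P)))).mp h
    have hs1 : (s : M.P) = 1 := by
      have h : (s : M.P) ∈ M.baseSec j ⊓ M.PiG := ⟨s.2, hsA⟩
      rwa [M.baseSec_inf_PiG hne hprime, Subgroup.mem_bot] at h
    rw [Subgroup.mem_bot]
    show θ s * s = 1
    rw [hs1, map_one, one_mul]
  have hle : M.cuspSection j n ≤ g.range := by
    refine Subgroup.topologicalClosure_minimal _ ((Subgroup.zpowers_le).mpr ?_) hclosed
    refine ⟨⟨M.baseGen j, M.baseGen_mem_baseSec j⟩, ?_⟩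
    show θ (M.baseGen j) * M.baseGen j = M.cuspGen j n
    have hθb : θ (M.baseGen j) = M.ι (SemidirectProduct.inl (c j ^ n : PuncturedSurfaceGroup 0 4)) := by
      rw [baseGen, map_mul, map_mul, hθA _ (Subgroup.le_topologicalClosure _ ⟨_, ⟨cuspTwist j, rfl⟩, rfl⟩),
        one_mul, hθt]
    rw [hθb, cuspGen_eq]
  rw [eq_bot_iff, ← hinf]
  exact inf_le_inf_right _ hle

/-- **`S_{j,n} ⊆ D_{c_j}`** (`ι(c_j)^n · s_j ∈ Π_{c_j} · I_v`, which is closed).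
[cite: MochizukiAbsTopII2013, Prop 1.3 (x) p.12] -/
theorem cuspSection_le_DvCusp (hne : Sigma.Nonempty) (hprime : ∀ p ∈ Sigma, p.Prime) (j : Fin 4) (n : ℕ) :
    M.cuspSection j n ≤ (M.dpsc hne hprime).DvCusp ⟨j⟩ := by
  refine Subgroup.topologicalClosure_minimal _ ((Subgroup.zpowers_le).mpr ?_) (M.isClosed_DvCusp hne hprime j)
  rw [DvCusp_eq_sup_baseSec, cuspGen_eq]
  exact Subgroup.mul_mem _ (Subgroup.mem_sup_left (M.inl_pow_mem_cuspGp_map j n))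
    (Subgroup.mem_sup_right (M.baseGen_mem_baseSec j))

/-! ### The family of log points -/

/-- **Labels of the log points of the degenerating 4-pointed sphere** (with repetitions): a smooth (non-cuspidal,
non-nodal) point of the component `v` with a conjugator `δ ∈ P`, or a log point over the cusp `c_j` of slope `n ≥ 1`
with a conjugator `δ ∈ P`.  No label for the node: over the regular smoothing (`i_e = 1`) no log point of
`X^{log}(S^{log})` maps to it. [cite: MochizukiAbsTopII2013, Prop 1.3 (x) p.12] -/
inductive LogPt (M : Model Sigma) : Type
  /-- a smooth point of the irreducible component `v`, section `δ I_v δ⁻¹` -/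
  | smooth (v : Fin 2) (δ : M.P)
  /-- a log point mapping to the cusp `c_j`, section `δ S_{j,n} δ⁻¹`, `n ≥ 1` -/
  | cusp (j : Fin 4) (n : ℕ) (hn : 0 < n) (δ : M.P)

/-- The inertia section of the vertex `v`: `I_{v_A} = T`, `I_{v_B} = U` (as subgroups of `P`).
[cite: MochizukiAbsTopII2013, Prop 1.3 (iii) p.11] -/
def vertSec : Fin 2 → Subgroup M.P := ![M.T, M.U]

/-- `vertSec 0 = T = I_{v_A}`. [cite: MochizukiAbsTopII2013, Prop 1.3 (iii) p.11] -/
theorem vertSec_zero : M.vertSec 0 = M.T := rfl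

/-- `vertSec 1 = U = I_{v_B}`. [cite: MochizukiAbsTopII2013, Prop 1.3 (iii) p.11] -/
theorem vertSec_one : M.vertSec 1 = M.U := rfl

/-- `vertSec v = I_v`. [cite: MochizukiAbsTopII2013, Prop 1.3 (iii) p.11] -/
theorem vertSec_eq_Iv (hne : Sigma.Nonempty) (hprime : ∀ p ∈ Sigma, p.Prime) (v : Fin 2) :
    M.vertSec v = (M.dpsc hne hprime).Iv ⟨v⟩ := by
  fin_cases v
  · exact (M.Iv_eq_T hne hprime).symm
  · exact (M.Iv_eq_U hne hprime).symm

/-- Every vertex of the datum is `⟨v⟩` for `v : Fin 2`, and `I_v = vertSec v`. [cite: MochizukiAbsTopII2013, Prop 1.3 (iii) p.11] -/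
theorem Iv_eq_vertSec (hne : Sigma.Nonempty) (hprime : ∀ p ∈ Sigma, p.Prime) (v : (M.dpsc hne hprime).Vert) :
    (M.dpsc hne hprime).Iv v = M.vertSec v.down := by
  rcases M.vert_cases hne hprime v with rfl | rfl
  · exact M.Iv_eq_T hne hprime
  · exact M.Iv_eq_U hne hprime

/-- `vertSec v` is closed. [cite: MochizukiAbsTopII2013, Prop 1.3 (iii) p.11] -/
theorem isClosed_vertSec (v : Fin 2) : IsClosed ((M.vertSec v : Subgroup M.P) : Set M.P) := by
  fin_cases v <;> exact Subgroup.isClosed_topologicalClosure _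

/-- `vertSec v ∩ Π_𝔾 = 1`. [cite: MochizukiAbsTopII2013, Prop 1.3 (iii) p.11] -/
theorem vertSec_inf_PiG (hne : Sigma.Nonempty) (hprime : ∀ p ∈ Sigma, p.Prime) (v : Fin 2) :
    M.vertSec v ⊓ M.PiG = ⊥ := by
  fin_cases v
  · exact M.T_inf_PiG
  · exact M.U_inf_PiG hne hprime

/-- `vertSec v · Π_𝔾 = P`. [cite: MochizukiAbsTopII2013, Prop 1.3 (iii) p.11] -/
theorem vertSec_sup_PiG (v : Fin 2) : M.vertSec v ⊔ M.PiG = ⊤ := by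
  fin_cases v
  · exact M.T_sup_PiG
  · exact M.U_sup_PiG

/-- **The log points of the two-vertex nodal model** as labelled sections (`DPSCIndexData.LogPointData`): smooth
points of `v` ↦ (`δ I_v δ⁻¹`, smooth `v`); log points over the cusp `c_j` ↦ (`δ S_{j,n} δ⁻¹`, cusp `c_j`), `n ≥ 1`.
The statement of record `Prop_1_3_x''` is evaluated on this family in `TwoTripodNodalProp13x.lean` (III).
[cite: MochizukiAbsTopII2013, Prop 1.3 (x) p.12] -/
def logPoints (hne : Sigma.Nonempty) (hprime : ∀ p ∈ Sigma, p.Prime) :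
    M.LogPt → (M.dpsc hne hprime).LogPointData
  | LogPt.smooth v δ =>
    { image := MulAut.conj δ • M.vertSec v
      image_le := le_top
      isClosed_image := M.isClosed_conj_smul (M.isClosed_vertSec v) δ
      image_inf := by
        rw [dpsc_PiG]; exact M.conj_smul_inf_PiG_eq_bot (M.vertSec_inf_PiG hne hprime v) δ
      image_sup := by
        rw [dpsc_PiG, dpsc_PiI]; exact M.conj_smul_sup_PiG_eq_top (M.vertSec_sup_PiG v) δ
      kind := DPSCIndexData.PointKind.smooth ⟨v⟩ }
  | LogPt.cusp j n _ δ =>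
    { image := MulAut.conj δ • M.cuspSection j n
      image_le := le_top
      isClosed_image := M.isClosed_conj_smul (M.isClosed_cuspSection j n) δ
      image_inf := by
        rw [dpsc_PiG]; exact M.conj_smul_inf_PiG_eq_bot (M.cuspSection_inf_PiG hne hprime j n) δ
      image_sup := by
        rw [dpsc_PiG, dpsc_PiI]; exact M.conj_smul_sup_PiG_eq_top (M.cuspSection_sup_PiG j n) δ
      kind := DPSCIndexData.PointKind.cusp ⟨j⟩ }

/-- The smooth member `(v, δ)` has section `δ I_v δ⁻¹` (`I_v = vertSec v`). [cite: MochizukiAbsTopII2013, Prop 1.3 (x) p.12] -/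
theorem logPoints_smooth_image (hne : Sigma.Nonempty) (hprime : ∀ p ∈ Sigma, p.Prime) (v : Fin 2) (δ : M.P) :
    (M.logPoints hne hprime (LogPt.smooth v δ)).image = MulAut.conj δ • M.vertSec v := rfl

/-- The smooth member `(v, δ)` is labelled "smooth point of `v`". [cite: MochizukiAbsTopII2013, Prop 1.3 (x) p.12] -/
theorem logPoints_smooth_kind (hne : Sigma.Nonempty) (hprime : ∀ p ∈ Sigma, p.Prime) (v : Fin 2) (δ : M.P) :
    (M.logPoints hne hprime (LogPt.smooth v δ)).kind = DPSCIndexData.PointKind.smooth ⟨v⟩ := rfl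

/-- The cusp member `(j, n, δ)` has section `δ S_{j,n} δ⁻¹`. [cite: MochizukiAbsTopII2013, Prop 1.3 (x) p.12] -/
theorem logPoints_cusp_image (hne : Sigma.Nonempty) (hprime : ∀ p ∈ Sigma, p.Prime) (j : Fin 4) (n : ℕ) (hn : 0 < n)
    (δ : M.P) : (M.logPoints hne hprime (LogPt.cusp j n hn δ)).image = MulAut.conj δ • M.cuspSection j n := rfl

/-- The cusp member `(j, n, δ)` is labelled "the cusp `c_j`". [cite: MochizukiAbsTopII2013, Prop 1.3 (x) p.12] -/
theorem logPoints_cusp_kind (hne : Sigma.Nonempty) (hprime : ∀ p ∈ Sigma, p.Prime) (j : Fin 4) (n : ℕ) (hn : 0 < n)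
    (δ : M.P) : (M.logPoints hne hprime (LogPt.cusp j n hn δ)).kind = DPSCIndexData.PointKind.cusp ⟨j⟩ := rfl

end Literature.AnabelianGeometry.AbsoluteAnabelian.AbsTopII.TwoTripodNodal.Model

end
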